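import Summits.CriticalPhenomena.PercolationContinuityZ3.Theorems.Transplant.HexShadowSideSqrt
import HarnessLib

/-!
# HEXAGONAL SHADOWS XIII — DST's Lemma 4 in hexagonal geometry: the landing interval `[a_m, b_m] ⊆ [0, α_m]` on the half-side of `hexBall c 2m`,
# and the slack `P[E_m(α_m + k, m)] → 1`

builds on p205010 (kernel theorem, internal audit signed; external expert review pending) — NOT used in this file.
Lane `prim-bschramm`, seat `prim-bschramm-p2` (gen 32; class C1b; memo `HOME/bschramm/P2-LATTICES.md` §115); helper file
(`--supports stmt-CriticalPhenomena-4575 --as helper`).  Slab original: `DuminilCopinSidoraviciusTassion2016_lemma4_holds` (`Literature/…/SlabCriticality`),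
whose one-dimensional argument is repeated here VERBATIM on the half-side `{c + (2m, x − m) : x ∈ [0, m]}` (scale `m`, hexagon `hexBall c 2m`):
the only two inputs — the local bound `P[E_m(x,x)] ≤ c < 1` and `P[E_m(0,m)] → 1` — are «HexShadowSideSqrt».
* §1 **`HexShadow.lemma4`** (`p < 1`; inner radii `v_m < 2m`; `P[hexBall c v_m ⟷^{hexBall c 2m} hexSphere c 2m] → 1`): sequences `α, a, b : ℕ → ℕ` with
  `1 ≤ α_m ≤ m`, `[a_m, b_m] ⊆ [0, α_m]`, `2(b_m − a_m) ≤ α_m + 1`, eventually `α_m + 1 ≤ m`, and `P[E_m(α_m, m)] → 1` (DST (4)),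
  `P[E_m(a_m, b_m)] → 1` (DST (5), lattice form).  (The degenerate density `p = 1` is excluded here; the eq.-(12) assembly treats it by connectedness.)
* §2 the SLACK needed to round the landing zone's centre to the symmetry lattice `period • ℤ²` (a hexagonal-shadow phenomenon absent from the slab, where
  every lattice translation is a symmetry): **`tendsto_real_sideEvent_add`** `P[E_m(α_m + k, m)] → 1` for every fixed `k` (a target of `k` consecutive
  side points is as unlikely as a single one, up to a constant `< 1`, by the same local bound and one more square-root trick per unit of `k`), and
  **`eventually_lt_of_tendsto_sideEvent`**: `P[E_m(β_m, m)] → 1 ⇒ β_m + 1 ≤ m` eventually.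
[cite: DuminilCopinSidoraviciusTassion2016, §2.1 Lemma 4, eqs. (4)–(9)] [cite: GrimmettPercolation1999, (11.14)]
-/

noncomputable section

namespace Summit.CriticalPhenomena.PercolationContinuityZ3.Theorems.Transplant

open MeasureTheory Literature.Probability.Percolation Literature.Probability.LatticeModels SimpleGraph Filter
open scoped Classical Topology

namespace HexShadow

variable {V : Type} {G : SimpleGraph V} (Φ : HexShadow G)

/-- An empty target interval gives the empty side event. [folklore] -/
theorem sideEvent_eq_empty (z : Site 2) (m u : ℕ) {α β : ℤ} (h : β < α) : Φ.sideEvent z m u α β = ∅ := by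
  ext ω
  simp only [sideEvent, conn, mem_openCrossing_iff, mem_lift, mem_hexSide, Set.mem_empty_iff_false, iff_false, not_exists, not_and]
  intro x _ y hy _
  exact absurd (hy.2.1.trans hy.2.2) (not_le.2 h)

/-- `1 − closedConst < 1` is eventually below the square-root-trick bound `1 − (1 − x_m)^{1/2}` when `x_m → 1`. [folklore] -/
theorem eventually_const_lt_sqrt_bound {x : ℕ → ℝ} {c : ℝ} (hc : c < 1) (hx1 : ∀ m, x m ≤ 1) (hx : Tendsto x atTop (𝓝 1)) :
    ∀ᶠ m in atTop, c < 1 - (1 - x m) ^ ((2 : ℝ)⁻¹) := by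
  have hε : 0 < (1 - c) ^ 2 := by nlinarith
  have hev := hx.eventually (Ioi_mem_nhds (show 1 - (1 - c) ^ 2 < 1 by linarith))
  refine hev.mono fun m hm => ?_
  have hm' : 1 - (1 - c) ^ 2 < x m := hm
  have h1 : 1 - x m < (1 - c) ^ 2 := by linarith
  have h2 : (1 - x m) ^ ((2 : ℝ)⁻¹) < ((1 - c) ^ 2) ^ ((2 : ℝ)⁻¹) := Real.rpow_lt_rpow (by linarith [hx1 m]) h1 (by norm_num)
  have h3 : ((1 - c) ^ 2) ^ ((2 : ℝ)⁻¹) = 1 - c := by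
    have := Real.pow_rpow_inv_natCast (show 0 ≤ 1 - c by linarith) two_ne_zero
    exact_mod_cast this
  linarith

/-! ## §1 Lemma 4 on the half-side of the even hexagon -/

/-- **DST 2016, Lemma 4, in hexagonal geometry** (scale `m` = the hexagon `hexBall c 2m`; half-side `x ∈ [0, m]` from the midpoint `x = 0` to the corner
`x = m`).  For `p < 1`, inner radii `v_m < 2m` (`m ≥ 1`) with `P_p[hexBall c v_m ⟷^{hexBall c 2m} hexSphere c 2m] → 1`, there are `α, a, b : ℕ → ℕ` with
`1 ≤ α_m ≤ m`, `a_m ≤ b_m ≤ α_m`, `2(b_m − a_m) ≤ α_m + 1` (`m ≥ 1`), `α_m + 1 ≤ m` eventually, `P_p[E_m(α_m, m)] → 1` (eq. (4)) and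
`P_p[E_m(a_m, b_m)] → 1` (eq. (5): `[a_m, b_m]` is the better half of `[0, α_m]`).  The printed proof verbatim: (7) `P[E(0,0)] < P[E(1,m)]` and (8)
`P[E(0,m−1)] > P[E(m,m)]` for `m` large from the local bound and `P[E(0,m)] → 1`; `α_m = max{α ≤ m−1 : P[E(0,α−1)] < P[E(α,m)]}`; (9); three more
square-root tricks. [cite: DuminilCopinSidoraviciusTassion2016, Lemma 4] -/
theorem lemma4 [Countable V] (p : unitInterval) (hp : (p : ℝ) < 1) (v : ℕ → ℕ) (hv : ∀ m, 1 ≤ m → v m < 2 * m)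
    (hD : Tendsto (fun m => (bondPercolation G p).real (Φ.conn (hexBall Φ.centre (2 * m)) (hexBall Φ.centre (v m)) (hexSphere Φ.centre (2 * m))))
      atTop (𝓝 1)) :
    ∃ α a b : ℕ → ℕ,
      (∀ m, 1 ≤ m → 1 ≤ α m ∧ α m ≤ m ∧ a m ≤ b m ∧ b m ≤ α m ∧ 2 * (b m - a m) ≤ α m + 1) ∧
      (∀ᶠ m in atTop, α m + 1 ≤ m) ∧
      Tendsto (fun m => (bondPercolation G p).real (Φ.sideEvent Φ.centre m (v m) (α m) m)) atTop (𝓝 1) ∧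
      Tendsto (fun m => (bondPercolation G p).real (Φ.sideEvent Φ.centre m (v m) (a m) (b m))) atTop (𝓝 1) := by
  classical
  set c₀ := Φ.centre with hc₀
  set P := bondPercolation G p with hP
  set f : ℕ → ℤ → ℤ → ℝ := fun m s t => P.real (Φ.sideEvent c₀ m (v m) s t) with hf
  have hf1 : ∀ m s t, f m s t ≤ 1 := fun m s t => measureReal_le_one
  have hf0 : ∀ m s t, 0 ≤ f m s t := fun m s t => measureReal_nonneg
  have hfm : ∀ (m : ℕ) (s t : ℤ), MeasurableSet (Φ.sideEvent c₀ m (v m) s t) := fun m s t => Φ.measurableSet_sideEvent c₀ m (v m) s t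
  have hfu : ∀ (m : ℕ) (s t : ℤ), IsUpperSet (Φ.sideEvent c₀ m (v m) s t) := fun m s t => Φ.isUpperSet_sideEvent c₀ m (v m) s t
  -- the two-event square-root trick in the form used below
  have hsq : ∀ (m : ℕ) (s μ t : ℤ), 1 - (1 - f m s t) ^ ((2 : ℝ)⁻¹) ≤ max (f m s μ) (f m (μ + 1) t) := fun m s μ t =>
    sqrt_trick_two_graph G p (hfu m s μ) (hfu m (μ + 1) t) (hfm m s μ) (hfm m (μ + 1) t) (Φ.sideEvent_subset_union c₀ m (v m) s μ t)
  -- (0) `f_m(0, m) → 1`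
  have h0n : Tendsto (fun m => f m 0 m) atTop (𝓝 1) := Φ.tendsto_real_sideEvent_upper p v hD
  -- the local bound `f_m(s, s) ≤ c < 1`
  set c : ℝ := 1 - Φ.closedConst p with hc
  have hc1 : c < 1 := by have := Φ.closedConst_pos p hp; rw [hc]; linarith
  have hloc : ∀ m, 1 ≤ m → ∀ s : ℤ, f m s s ≤ c := fun m hm s => Φ.real_sideEvent_point_le p c₀ (hv m hm) s
  -- eventually `c < 1 - (1 - f_m(0,m))^{1/2}`
  have hevc : ∀ᶠ m in atTop, c < 1 - (1 - f m 0 m) ^ ((2 : ℝ)⁻¹) := eventually_const_lt_sqrt_bound hc1 (fun m => hf1 m 0 m) h0n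
  -- (7) and (8), eventually
  set Good : ℕ → Prop := fun m => 2 ≤ m ∧ f m 0 0 < f m 1 m ∧ f m m m < f m 0 ((m : ℤ) - 1) with hGood
  have hGoodev : ∀ᶠ m in atTop, Good m := by
    refine ((Filter.eventually_ge_atTop 2).and hevc).mono fun m hm => ⟨hm.1, ?_, ?_⟩
    · have hst := hsq m 0 0 m
      rw [zero_add] at hst
      have hmax : c < max (f m 0 0) (f m 1 m) := lt_of_lt_of_le hm.2 hst
      have h00 : f m 0 0 ≤ c := hloc m (by omega) 0
      rcases le_or_gt (f m 1 m) (f m 0 0) with h | h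
      · rw [max_eq_left h] at hmax; linarith
      · exact h
    · have hst := hsq m 0 ((m : ℤ) - 1) m
      rw [sub_add_cancel] at hst
      have hmax : c < max (f m 0 ((m : ℤ) - 1)) (f m m m) := lt_of_lt_of_le hm.2 hst
      have hmm : f m m m ≤ c := hloc m (by omega) m
      rcases le_or_gt (f m 0 ((m : ℤ) - 1)) (f m m m) with h | h
      · rw [max_eq_right h] at hmax; linarith
      · exact h
  -- `α_m`
  set pr : ℕ → ℕ → Prop := fun m μ => f m 0 ((μ : ℤ) - 1) < f m μ m with hpr
  set α : ℕ → ℕ := fun m => if Good m then Nat.findGreatest (pr m) (m - 1) else 1 with hα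
  have hαG : ∀ m, Good m → 1 ≤ α m ∧ α m ≤ m - 1 ∧ pr m (α m) ∧ f m ((α m : ℤ) + 1) m ≤ f m 0 (α m) := by
    intro m hG
    have hαm : α m = Nat.findGreatest (pr m) (m - 1) := if_pos hG
    have hp1' : pr m 1 := by
      simp only [hpr]; push_cast; simpa using hG.2.1
    have h1 : 1 ≤ Nat.findGreatest (pr m) (m - 1) := Nat.le_findGreatest (by omega) hp1'
    have h2 : Nat.findGreatest (pr m) (m - 1) ≤ m - 1 := Nat.findGreatest_le _
    have h3 : pr m (Nat.findGreatest (pr m) (m - 1)) := Nat.findGreatest_spec (m := 1) (by omega) hp1'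
    rw [hαm]
    refine ⟨h1, h2, h3, ?_⟩
    rcases lt_or_eq_of_le h2 with hlt | heq
    · have hng := Nat.findGreatest_is_greatest (Nat.lt_succ_self (Nat.findGreatest (pr m) (m - 1))) (Nat.succ_le_of_lt hlt)
      simp only [hpr, not_lt] at hng
      push_cast at hng
      simpa using hng
    · rw [heq]
      have h8 := hG.2.2
      have e : ((m - 1 : ℕ) : ℤ) = (m : ℤ) - 1 := by
        have : 1 ≤ m := by omega
        push_cast [Nat.cast_sub this]; ring
      rw [e, sub_add_cancel]
      exact h8.le
  -- `[a_m, b_m]`: the better half of `[0, α_m]`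
  set cond : ℕ → Prop := fun m => f m ((α m / 2 : ℕ) + 1 : ℤ) (α m) ≤ f m 0 (α m / 2 : ℕ) with hcond
  set a : ℕ → ℕ := fun m => if Good m then (if cond m then 0 else α m / 2 + 1) else 0 with ha
  set b : ℕ → ℕ := fun m => if Good m then (if cond m then α m / 2 else α m) else 0 with hb
  refine ⟨α, a, b, ?_, ?_, ?_, ?_⟩
  · -- bounds
    intro m hm
    by_cases hG : Good m
    · obtain ⟨h1, h2, -, -⟩ := hαG m hG
      have hαm : 1 ≤ α m ∧ α m ≤ m := ⟨h1, by omega⟩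
      simp only [ha, hb, if_pos hG]
      split_ifs <;> omega
    · simp only [hα, ha, hb, if_neg hG]
      omega
  · -- eventually `α_m + 1 ≤ m`
    refine hGoodev.mono fun m hG => ?_
    obtain ⟨-, h2, -, -⟩ := hαG m hG
    have := hG.1
    omega
  · -- (4): `f_m(α_m, m) → 1`
    refine tendsto_one_of_sqrt_trick (r := (2 : ℝ)⁻¹) (by norm_num) h0n (fun m => hf1 m _ _) (hGoodev.mono fun m hG => ?_)
    obtain ⟨-, -, h3, -⟩ := hαG m hG
    have hst := hsq m 0 ((α m : ℤ) - 1) m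
    rw [sub_add_cancel] at hst
    have hlt : f m 0 ((α m : ℤ) - 1) < f m (α m) m := h3
    rw [max_eq_right hlt.le] at hst
    exact hst
  · -- (5): `f_m(a_m, b_m) → 1`, via `f_m(0, α_m) → 1`
    have h0α : Tendsto (fun m => f m 0 (α m)) atTop (𝓝 1) := by
      refine tendsto_one_of_sqrt_trick (r := (2 : ℝ)⁻¹) (by norm_num) h0n (fun m => hf1 m _ _) (hGoodev.mono fun m hG => ?_)
      obtain ⟨-, -, -, h4⟩ := hαG m hG
      have hst := hsq m 0 (α m) m
      rw [max_eq_left h4] at hst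
      exact hst
    refine tendsto_one_of_sqrt_trick (r := (2 : ℝ)⁻¹) (by norm_num) h0α (fun m => hf1 m _ _) (hGoodev.mono fun m hG => ?_)
    have hst := hsq m 0 (α m / 2 : ℕ) (α m)
    show 1 - (1 - f m 0 (α m)) ^ ((2 : ℝ)⁻¹) ≤ f m (a m) (b m)
    have hab : f m (a m) (b m) = max (f m 0 (α m / 2 : ℕ)) (f m ((α m / 2 : ℕ) + 1 : ℤ) (α m)) := by
      by_cases hc' : cond m
      · have ha' : a m = 0 := by simp only [ha, if_pos hG, if_pos hc']
        have hb' : b m = α m / 2 := by simp only [hb, if_pos hG, if_pos hc']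
        rw [ha', hb', max_eq_left hc']
        push_cast
        rfl
      · have ha' : a m = α m / 2 + 1 := by simp only [ha, if_pos hG, if_neg hc']
        have hb' : b m = α m := by simp only [hb, if_pos hG, if_neg hc']
        rw [ha', hb', max_eq_right (le_of_not_ge hc')]
        push_cast
        rfl
    rw [hab]
    exact hst

/-! ## §2 The slack: `k` more side points cost nothing in the limit -/

/-- **`P[E_m(β_m, m)] → 1 ⇒ β_m + 1 ≤ m` eventually** (a target beyond the corner is empty, the corner alone is a single column). [folklore] -/
theorem eventually_lt_of_tendsto_sideEvent [Countable V] (p : unitInterval) (hp : (p : ℝ) < 1) (v : ℕ → ℕ) (hv : ∀ m, 1 ≤ m → v m < 2 * m)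
    {β : ℕ → ℕ} (hβ : Tendsto (fun m => (bondPercolation G p).real (Φ.sideEvent Φ.centre m (v m) (β m) m)) atTop (𝓝 1)) :
    ∀ᶠ m in atTop, β m + 1 ≤ m := by
  set c : ℝ := 1 - Φ.closedConst p with hc
  have hc1 : c < 1 := by have := Φ.closedConst_pos p hp; rw [hc]; linarith
  have hev := hβ.eventually (Ioi_mem_nhds hc1)
  refine ((Filter.eventually_ge_atTop 1).and hev).mono fun m hm => ?_
  obtain ⟨hm1, hm2⟩ := hm
  have hgt : c < (bondPercolation G p).real (Φ.sideEvent Φ.centre m (v m) (β m) m) := hm2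
  by_contra hcon
  rcases lt_or_eq_of_le (show m ≤ β m by omega) with h | h
  · rw [Φ.sideEvent_eq_empty Φ.centre m (v m) (by exact_mod_cast h), measureReal_empty] at hgt
    have : 0 ≤ Φ.closedConst p := measureReal_nonneg
    have : Φ.closedConst p ≤ 1 := measureReal_le_one
    linarith
  · have hle := Φ.real_sideEvent_point_le p Φ.centre (hv m hm1) (m : ℤ)
    rw [← h] at hgt
    linarith

/-- **THE SLACK: `P[E_m(α_m, m)] → 1 ⇒ P[E_m(α_m + k, m)] → 1`** for every fixed `k` (induction on `k`: `E(α+k, m) ⊆ E(α+k, α+k) ∪ E(α+k+1, m)`, the first has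
probability `≤ 1 − closedConst < 1`, so the square-root-trick bound falls on the second).  Needed to centre the landing zone of Lemma 6 at a point of the
symmetry lattice `c + period • ℤ²`. [cite: DuminilCopinSidoraviciusTassion2016, Lemma 4 (proof, eq. (6) and the square-root trick)] -/
theorem tendsto_real_sideEvent_add [Countable V] (p : unitInterval) (hp : (p : ℝ) < 1) (v : ℕ → ℕ) (hv : ∀ m, 1 ≤ m → v m < 2 * m)
    {α : ℕ → ℕ} (hα : Tendsto (fun m => (bondPercolation G p).real (Φ.sideEvent Φ.centre m (v m) (α m) m)) atTop (𝓝 1)) (k : ℕ) :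
    Tendsto (fun m => (bondPercolation G p).real (Φ.sideEvent Φ.centre m (v m) (α m + k) m)) atTop (𝓝 1) := by
  set P := bondPercolation G p with hP
  set c : ℝ := 1 - Φ.closedConst p with hc
  have hc1 : c < 1 := by have := Φ.closedConst_pos p hp; rw [hc]; linarith
  induction k with
  | zero => simpa using hα
  | succ k ih =>
    have hevc : ∀ᶠ m in atTop, c < 1 - (1 - P.real (Φ.sideEvent Φ.centre m (v m) (α m + k) m)) ^ ((2 : ℝ)⁻¹) :=
      eventually_const_lt_sqrt_bound hc1 (fun m => measureReal_le_one) ih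
    refine tendsto_one_of_sqrt_trick (r := (2 : ℝ)⁻¹) (by norm_num) ih (fun m => measureReal_le_one)
      (((Filter.eventually_ge_atTop 1).and hevc).mono fun m hm => ?_)
    obtain ⟨hm1, hm2⟩ := hm
    have hst := sqrt_trick_two_graph G p (Φ.isUpperSet_sideEvent Φ.centre m (v m) ((α m + k : ℕ) : ℤ) ((α m + k : ℕ) : ℤ))
      (Φ.isUpperSet_sideEvent Φ.centre m (v m) (((α m + k : ℕ) : ℤ) + 1) m) (Φ.measurableSet_sideEvent _ _ _ _ _) (Φ.measurableSet_sideEvent _ _ _ _ _)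
      (Φ.sideEvent_subset_union Φ.centre m (v m) ((α m + k : ℕ) : ℤ) ((α m + k : ℕ) : ℤ) m)
    have hloc : P.real (Φ.sideEvent Φ.centre m (v m) ((α m + k : ℕ) : ℤ) ((α m + k : ℕ) : ℤ)) ≤ c := Φ.real_sideEvent_point_le p Φ.centre (hv m hm1) _
    have hmax := lt_of_lt_of_le hm2 hst
    rcases le_or_gt (P.real (Φ.sideEvent Φ.centre m (v m) (((α m + k : ℕ) : ℤ) + 1) m))
      (P.real (Φ.sideEvent Φ.centre m (v m) ((α m + k : ℕ) : ℤ) ((α m + k : ℕ) : ℤ))) with h | h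
    · rw [max_eq_left h] at hmax; linarith
    · rw [max_eq_right h.le] at hst
      push_cast at hst ⊢
      rw [show (α m : ℤ) + ((k : ℤ) + 1) = (α m : ℤ) + k + 1 by ring]
      exact hst

end HexShadow

end Summit.CriticalPhenomena.PercolationContinuityZ3.Theorems.Transplant

end
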